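import Summits.ValiantsHypothesis.ValiantsHypothesis.Theorems.LacunarySymmetroidMatrixDescartesCensusTwoRowBoxLeaf

/-!
# `MatrixDescartes` census — W4 boundary layer, kernel kit: TWO-ROW-BOX LEAF, part 2 — the SDD certificate

HONEST FRAMING — as in `…CensusTwoRowBoxLeaf` (library file, engine-1 g25, O4 / R1945 / R1950; item `DoorA26 = PosRootLawAt 2 6 19`,
stmt-ValiantsHypothesis-19979, OPEN, typed, never asserted).  One SUFFICIENT certificate for the hypothesis `hneg` of the core lemmas
(`countP_posRoots_twoRow₂/₃_le_one`): SCALED DIAGONAL DOMINANCE of the Wronskian form on a ν-box.  Data of an instance: the box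
`lo_j B_j κ_d ≤ κ_n A_j ≤ hi_j B_j κ_d` (`κ = κ_n/κ_d > 0` a free letter ratio — in HYBRID27's letters `|a_{i₂}|/|a_{i₁}|`, and
`κA_j/B_j = ν̃_j`), numbers `T_jk ≥ 0` with `c_jk ν_j + c_kj ν_k ≤ 2T_jk` at the four corners of the `(j,k)` face (`c_jk = (a+d_j) − (b+d_k)`),
weights `ρ_jk > 0` with `ρ_jk ρ_kj = 1`, and the `m` strict inequalities `Σ_{k≠j} T_jk ρ_jk < (b − a)·lo_j`.  Every side goal of an
instance is `norm_num` on small rationals.  Located reach (engine-1 g25, tools/engine1/g25/boxleaf/sddtest.py): 100 of the 109 (Q)-leaves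
in the HYBRID27 trees of record.  Nothing here bounds `ζ_sym(2,6)`, decides `DoorA26`, or bears on `MatrixDescartes`
(stmt-ValiantsHypothesis-18050) / `VP ≠ VNP`.

[folklore] Termwise bounds + weighted AM–GM; no single source.
-/

set_option linter.dupNamespace false

namespace Summit.ValiantsHypothesis.ValiantsHypothesis.Theorems.LacunarySymmetroidMatrixDescartes.Census

/-! ### The scaled-diagonal-dominance (SDD) certificate on a ν-box -/

/-- Weighted AM–GM with reciprocal weights: `ρ > 0`, `ρ·ρ' = 1`, `T ≥ 0` ⇒ `2T·u·v ≤ T·(ρu² + ρ'v²)`. [folklore] -/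
theorem two_mul_le_of_recip_weights {ρ ρ' T u v : ℝ} (hρ : 0 < ρ) (hρρ : ρ * ρ' = 1) (hT : 0 ≤ T) :
    2 * T * (u * v) ≤ T * (ρ * (u * u) + ρ' * (v * v)) := by
  have key : ρ * (ρ * (u * u) + ρ' * (v * v) - 2 * (u * v)) = (ρ * u - v) ^ 2 := by
    have : ρ * (ρ * (u * u) + ρ' * (v * v) - 2 * (u * v)) = ρ ^ 2 * u ^ 2 + (ρ * ρ') * v ^ 2 - 2 * ρ * u * v := by ring
    rw [this, hρρ]; ring
  have h0 : 0 ≤ ρ * (u * u) + ρ' * (v * v) - 2 * (u * v) := by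
    have h := sq_nonneg (ρ * u - v)
    rw [← key] at h
    exact (mul_nonneg_iff_of_pos_left hρ).mp h
  nlinarith [mul_nonneg hT h0]

/-- **Corner bound for one cross pair.**  On the box `lo_j B_j ≤ κA_j ≤ hi_j B_j`, `lo_k B_k ≤ κA_k ≤ hi_k B_k` (`B_j, B_k > 0`) the
symmetrised cross coefficient `c·κA_j·B_k + c'·κA_k·B_j` (affine in `(κA_j/B_j, κA_k/B_k)`) is at most `2T·B_jB_k` as soon as
`2T` dominates its four corner values. [folklore] -/
theorem cross_le_of_corners {κ Aj Ak Bj Bk loj hij lok hik c c' T : ℝ} (hBj : 0 < Bj) (hBk : 0 < Bk)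
    (hloj : loj * Bj ≤ κ * Aj) (hhij : κ * Aj ≤ hij * Bj) (hlok : lok * Bk ≤ κ * Ak) (hhik : κ * Ak ≤ hik * Bk)
    (h1 : c * loj + c' * lok ≤ 2 * T) (h2 : c * loj + c' * hik ≤ 2 * T) (h3 : c * hij + c' * lok ≤ 2 * T)
    (h4 : c * hij + c' * hik ≤ 2 * T) :
    c * (κ * Aj) * Bk + c' * (κ * Ak) * Bj ≤ 2 * T * (Bj * Bk) := by
  have hBB : 0 ≤ Bj * Bk := (mul_pos hBj hBk).le
  rcases le_total 0 c with hc | hc <;> rcases le_total 0 c' with hc' | hc'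
  · have ej : c * (κ * Aj) ≤ c * (hij * Bj) := mul_le_mul_of_nonneg_left hhij hc
    have ek : c' * (κ * Ak) ≤ c' * (hik * Bk) := mul_le_mul_of_nonneg_left hhik hc'
    nlinarith [mul_le_mul_of_nonneg_right ej hBk.le, mul_le_mul_of_nonneg_right ek hBj.le, mul_le_mul_of_nonneg_right h4 hBB]
  · have ej : c * (κ * Aj) ≤ c * (hij * Bj) := mul_le_mul_of_nonneg_left hhij hc
    have ek : c' * (κ * Ak) ≤ c' * (lok * Bk) := mul_le_mul_of_nonpos_left hlok hc'
    nlinarith [mul_le_mul_of_nonneg_right ej hBk.le, mul_le_mul_of_nonneg_right ek hBj.le, mul_le_mul_of_nonneg_right h3 hBB]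
  · have ej : c * (κ * Aj) ≤ c * (loj * Bj) := mul_le_mul_of_nonpos_left hloj hc
    have ek : c' * (κ * Ak) ≤ c' * (hik * Bk) := mul_le_mul_of_nonneg_left hhik hc'
    nlinarith [mul_le_mul_of_nonneg_right ej hBk.le, mul_le_mul_of_nonneg_right ek hBj.le, mul_le_mul_of_nonneg_right h2 hBB]
  · have ej : c * (κ * Aj) ≤ c * (loj * Bj) := mul_le_mul_of_nonpos_left hloj hc
    have ek : c' * (κ * Ak) ≤ c' * (lok * Bk) := mul_le_mul_of_nonpos_left hlok hc'
    nlinarith [mul_le_mul_of_nonneg_right ej hBk.le, mul_le_mul_of_nonneg_right ek hBj.le, mul_le_mul_of_nonneg_right h1 hBB]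

/-- **Diagonal bound.**  `lo B ≤ κA`, `a < b` ⇒ `(a − b)·κA·B·w² ≤ (a − b)·lo·(Bw)²`. [folklore] -/
theorem diag_le_of_lo {κ A B lo w : ℝ} {a b : ℕ} (hB : 0 < B) (hab : a < b) (hlo : lo * B ≤ κ * A) :
    ((a : ℝ) - b) * (κ * A) * B * (w * w) ≤ ((a : ℝ) - b) * lo * ((B * w) * (B * w)) := by
  have hab' : ((a : ℝ) - b) ≤ 0 := by
    have : (a : ℝ) < b := by exact_mod_cast hab
    linarith
  have h1 : ((a : ℝ) - b) * (κ * A) ≤ ((a : ℝ) - b) * (lo * B) := mul_le_mul_of_nonpos_left hlo hab'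
  have h2 : 0 ≤ B * (w * w) := mul_nonneg hB.le (mul_self_nonneg w)
  nlinarith [mul_le_mul_of_nonneg_right h1 h2]

/-- **SDD certificate, `m = 2`.**  On the ν-box `lo_j B_j ≤ κA_j ≤ hi_j B_j` (`κ > 0`, all `B_j > 0`, `a < b`), numbers `T_jk ≥ 0`
dominating the symmetrised cross coefficients at the four corners of each `(j,k)` face and weights `ρ_jk > 0`, `ρ_jk ρ_kj = 1`
with `Σ_{k≠j} T_jk ρ_jk < (b − a)·lo_j` for every `j` make the Wronskian form negative on the open orthant (feeds
`countP_posRoots_twoRow₂_le_one`).  All side conditions of an instance are numeric. [folklore] -/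
theorem twoRow₂_form_neg_of_sdd (A₁ A₂ B₁ B₂ κn κd lo₁ lo₂ hi₁ hi₂ T₁₂ ρ₁₂ ρ₂₁ : ℝ) (a b d₁ d₂ : ℕ)
    (hB₁ : 0 < B₁) (hB₂ : 0 < B₂) (hκn : 0 < κn) (hκd : 0 < κd) (hab : a < b)
    (hlo₁' : lo₁ * B₁ * κd ≤ κn * A₁) (hhi₁' : κn * A₁ ≤ hi₁ * B₁ * κd)
    (hlo₂' : lo₂ * B₂ * κd ≤ κn * A₂) (hhi₂' : κn * A₂ ≤ hi₂ * B₂ * κd)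
    (hT₁₂ : 0 ≤ T₁₂) (hρ₁₂ : 0 < ρ₁₂) (hρρ₁₂ : ρ₁₂ * ρ₂₁ = 1)
    (hc₁₂ll : ((a : ℝ) + d₁ - ((b : ℝ) + d₂)) * lo₁ + ((a : ℝ) + d₂ - ((b : ℝ) + d₁)) * lo₂ ≤ 2 * T₁₂)
    (hc₁₂lh : ((a : ℝ) + d₁ - ((b : ℝ) + d₂)) * lo₁ + ((a : ℝ) + d₂ - ((b : ℝ) + d₁)) * hi₂ ≤ 2 * T₁₂)
    (hc₁₂hl : ((a : ℝ) + d₁ - ((b : ℝ) + d₂)) * hi₁ + ((a : ℝ) + d₂ - ((b : ℝ) + d₁)) * lo₂ ≤ 2 * T₁₂)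
    (hc₁₂hh : ((a : ℝ) + d₁ - ((b : ℝ) + d₂)) * hi₁ + ((a : ℝ) + d₂ - ((b : ℝ) + d₁)) * hi₂ ≤ 2 * T₁₂)
    (hsdd₁ : T₁₂ * ρ₁₂ < ((b : ℝ) - a) * lo₁)
    (hsdd₂ : T₁₂ * ρ₂₁ < ((b : ℝ) - a) * lo₂)
    : ∀ w₁ w₂ : ℝ, 0 < w₁ → 0 < w₂ →
      A₁ * B₁ * ((a : ℝ) + d₁ - ((b : ℝ) + d₁)) * (w₁ * w₁) + A₁ * B₂ * ((a : ℝ) + d₁ - ((b : ℝ) + d₂)) * (w₁ * w₂) + A₂ * B₁ * ((a : ℝ) + d₂ - ((b : ℝ) + d₁)) * (w₂ * w₁) + A₂ * B₂ * ((a : ℝ) + d₂ - ((b : ℝ) + d₂)) * (w₂ * w₂) < 0 := by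
  intro w₁ w₂ hw₁ hw₂
  set κ : ℝ := κn / κd with hκ_def
  have hκ : 0 < κ := div_pos hκn hκd
  have hlo₁ : lo₁ * B₁ ≤ κ * A₁ := by
    rw [hκ_def, div_mul_eq_mul_div, le_div_iff₀ hκd]; exact hlo₁'
  have hhi₁ : κ * A₁ ≤ hi₁ * B₁ := by
    rw [hκ_def, div_mul_eq_mul_div, div_le_iff₀ hκd]; exact hhi₁'
  have hlo₂ : lo₂ * B₂ ≤ κ * A₂ := by
    rw [hκ_def, div_mul_eq_mul_div, le_div_iff₀ hκd]; exact hlo₂'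
  have hhi₂ : κ * A₂ ≤ hi₂ * B₂ := by
    rw [hκ_def, div_mul_eq_mul_div, div_le_iff₀ hκd]; exact hhi₂'
  have hu₁ : 0 < B₁ * w₁ := mul_pos hB₁ hw₁
  have hu₂ : 0 < B₂ * w₂ := mul_pos hB₂ hw₂
  have dg₁ := diag_le_of_lo (w := w₁) hB₁ hab hlo₁
  have dg₂ := diag_le_of_lo (w := w₂) hB₂ hab hlo₂
  have cr₁₂ := mul_le_mul_of_nonneg_right
    (cross_le_of_corners (c := ((a : ℝ) + d₁ - ((b : ℝ) + d₂))) (c' := ((a : ℝ) + d₂ - ((b : ℝ) + d₁))) hB₁ hB₂ hlo₁ hhi₁ hlo₂ hhi₂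
      hc₁₂ll hc₁₂lh hc₁₂hl hc₁₂hh) (mul_pos hw₁ hw₂).le
  have am₁₂ := two_mul_le_of_recip_weights (u := B₁ * w₁) (v := B₂ * w₂) hρ₁₂ hρρ₁₂ hT₁₂
  have br₁ : (((a : ℝ) - b) * lo₁ + (T₁₂ * ρ₁₂)) * ((B₁ * w₁) * (B₁ * w₁)) < 0 :=
    mul_neg_of_neg_of_pos (by linarith) (mul_pos hu₁ hu₁)
  have br₂ : (((a : ℝ) - b) * lo₂ + (T₁₂ * ρ₂₁)) * ((B₂ * w₂) * (B₂ * w₂)) < 0 :=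
    mul_neg_of_neg_of_pos (by linarith) (mul_pos hu₂ hu₂)
  have hκform : κ * (A₁ * B₁ * ((a : ℝ) + d₁ - ((b : ℝ) + d₁)) * (w₁ * w₁) + A₁ * B₂ * ((a : ℝ) + d₁ - ((b : ℝ) + d₂)) * (w₁ * w₂) + A₂ * B₁ * ((a : ℝ) + d₂ - ((b : ℝ) + d₁)) * (w₂ * w₁) + A₂ * B₂ * ((a : ℝ) + d₂ - ((b : ℝ) + d₂)) * (w₂ * w₂)) < 0 := by
    calc κ * (A₁ * B₁ * ((a : ℝ) + d₁ - ((b : ℝ) + d₁)) * (w₁ * w₁) + A₁ * B₂ * ((a : ℝ) + d₁ - ((b : ℝ) + d₂)) * (w₁ * w₂) + A₂ * B₁ * ((a : ℝ) + d₂ - ((b : ℝ) + d₁)) * (w₂ * w₁) + A₂ * B₂ * ((a : ℝ) + d₂ - ((b : ℝ) + d₂)) * (w₂ * w₂))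
          = (((a : ℝ) - b) * (κ * A₁) * B₁ * (w₁ * w₁) + ((a : ℝ) - b) * (κ * A₂) * B₂ * (w₂ * w₂)) + ((((a : ℝ) + d₁ - ((b : ℝ) + d₂)) * (κ * A₁) * B₂ + ((a : ℝ) + d₂ - ((b : ℝ) + d₁)) * (κ * A₂) * B₁) * (w₁ * w₂)) := by ring
      _ ≤ (((a : ℝ) - b) * lo₁ * ((B₁ * w₁) * (B₁ * w₁)) + ((a : ℝ) - b) * lo₂ * ((B₂ * w₂) * (B₂ * w₂))) + (2 * T₁₂ * (B₁ * B₂) * (w₁ * w₂)) := by linarith [dg₁, dg₂, cr₁₂]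
      _ = (((a : ℝ) - b) * lo₁ * ((B₁ * w₁) * (B₁ * w₁)) + ((a : ℝ) - b) * lo₂ * ((B₂ * w₂) * (B₂ * w₂))) + (2 * T₁₂ * ((B₁ * w₁) * (B₂ * w₂))) := by ring
      _ ≤ (((a : ℝ) - b) * lo₁ * ((B₁ * w₁) * (B₁ * w₁)) + ((a : ℝ) - b) * lo₂ * ((B₂ * w₂) * (B₂ * w₂))) + (T₁₂ * (ρ₁₂ * ((B₁ * w₁) * (B₁ * w₁)) + ρ₂₁ * ((B₂ * w₂) * (B₂ * w₂)))) := by linarith [am₁₂]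
      _ = (((a : ℝ) - b) * lo₁ + (T₁₂ * ρ₁₂)) * ((B₁ * w₁) * (B₁ * w₁)) + (((a : ℝ) - b) * lo₂ + (T₁₂ * ρ₂₁)) * ((B₂ * w₂) * (B₂ * w₂)) := by ring
      _ < 0 := by linarith [br₁, br₂]
  by_contra hcon
  have : 0 ≤ κ * (A₁ * B₁ * ((a : ℝ) + d₁ - ((b : ℝ) + d₁)) * (w₁ * w₁) + A₁ * B₂ * ((a : ℝ) + d₁ - ((b : ℝ) + d₂)) * (w₁ * w₂) + A₂ * B₁ * ((a : ℝ) + d₂ - ((b : ℝ) + d₁)) * (w₂ * w₁) + A₂ * B₂ * ((a : ℝ) + d₂ - ((b : ℝ) + d₂)) * (w₂ * w₂)) := mul_nonneg hκ.le (not_lt.mp hcon)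
  linarith

/-- **SDD certificate, `m = 3`.**  On the ν-box `lo_j B_j ≤ κA_j ≤ hi_j B_j` (`κ > 0`, all `B_j > 0`, `a < b`), numbers `T_jk ≥ 0`
dominating the symmetrised cross coefficients at the four corners of each `(j,k)` face and weights `ρ_jk > 0`, `ρ_jk ρ_kj = 1`
with `Σ_{k≠j} T_jk ρ_jk < (b − a)·lo_j` for every `j` make the Wronskian form negative on the open orthant (feeds
`countP_posRoots_twoRow₃_le_one`).  All side conditions of an instance are numeric. [folklore] -/
theorem twoRow₃_form_neg_of_sdd (A₁ A₂ A₃ B₁ B₂ B₃ κn κd lo₁ lo₂ lo₃ hi₁ hi₂ hi₃ T₁₂ T₁₃ T₂₃ ρ₁₂ ρ₂₁ ρ₁₃ ρ₃₁ ρ₂₃ ρ₃₂ : ℝ) (a b d₁ d₂ d₃ : ℕ)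
    (hB₁ : 0 < B₁) (hB₂ : 0 < B₂) (hB₃ : 0 < B₃) (hκn : 0 < κn) (hκd : 0 < κd) (hab : a < b)
    (hlo₁' : lo₁ * B₁ * κd ≤ κn * A₁) (hhi₁' : κn * A₁ ≤ hi₁ * B₁ * κd)
    (hlo₂' : lo₂ * B₂ * κd ≤ κn * A₂) (hhi₂' : κn * A₂ ≤ hi₂ * B₂ * κd)
    (hlo₃' : lo₃ * B₃ * κd ≤ κn * A₃) (hhi₃' : κn * A₃ ≤ hi₃ * B₃ * κd)
    (hT₁₂ : 0 ≤ T₁₂) (hρ₁₂ : 0 < ρ₁₂) (hρρ₁₂ : ρ₁₂ * ρ₂₁ = 1)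
    (hc₁₂ll : ((a : ℝ) + d₁ - ((b : ℝ) + d₂)) * lo₁ + ((a : ℝ) + d₂ - ((b : ℝ) + d₁)) * lo₂ ≤ 2 * T₁₂)
    (hc₁₂lh : ((a : ℝ) + d₁ - ((b : ℝ) + d₂)) * lo₁ + ((a : ℝ) + d₂ - ((b : ℝ) + d₁)) * hi₂ ≤ 2 * T₁₂)
    (hc₁₂hl : ((a : ℝ) + d₁ - ((b : ℝ) + d₂)) * hi₁ + ((a : ℝ) + d₂ - ((b : ℝ) + d₁)) * lo₂ ≤ 2 * T₁₂)
    (hc₁₂hh : ((a : ℝ) + d₁ - ((b : ℝ) + d₂)) * hi₁ + ((a : ℝ) + d₂ - ((b : ℝ) + d₁)) * hi₂ ≤ 2 * T₁₂)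
    (hT₁₃ : 0 ≤ T₁₃) (hρ₁₃ : 0 < ρ₁₃) (hρρ₁₃ : ρ₁₃ * ρ₃₁ = 1)
    (hc₁₃ll : ((a : ℝ) + d₁ - ((b : ℝ) + d₃)) * lo₁ + ((a : ℝ) + d₃ - ((b : ℝ) + d₁)) * lo₃ ≤ 2 * T₁₃)
    (hc₁₃lh : ((a : ℝ) + d₁ - ((b : ℝ) + d₃)) * lo₁ + ((a : ℝ) + d₃ - ((b : ℝ) + d₁)) * hi₃ ≤ 2 * T₁₃)
    (hc₁₃hl : ((a : ℝ) + d₁ - ((b : ℝ) + d₃)) * hi₁ + ((a : ℝ) + d₃ - ((b : ℝ) + d₁)) * lo₃ ≤ 2 * T₁₃)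
    (hc₁₃hh : ((a : ℝ) + d₁ - ((b : ℝ) + d₃)) * hi₁ + ((a : ℝ) + d₃ - ((b : ℝ) + d₁)) * hi₃ ≤ 2 * T₁₃)
    (hT₂₃ : 0 ≤ T₂₃) (hρ₂₃ : 0 < ρ₂₃) (hρρ₂₃ : ρ₂₃ * ρ₃₂ = 1)
    (hc₂₃ll : ((a : ℝ) + d₂ - ((b : ℝ) + d₃)) * lo₂ + ((a : ℝ) + d₃ - ((b : ℝ) + d₂)) * lo₃ ≤ 2 * T₂₃)
    (hc₂₃lh : ((a : ℝ) + d₂ - ((b : ℝ) + d₃)) * lo₂ + ((a : ℝ) + d₃ - ((b : ℝ) + d₂)) * hi₃ ≤ 2 * T₂₃)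
    (hc₂₃hl : ((a : ℝ) + d₂ - ((b : ℝ) + d₃)) * hi₂ + ((a : ℝ) + d₃ - ((b : ℝ) + d₂)) * lo₃ ≤ 2 * T₂₃)
    (hc₂₃hh : ((a : ℝ) + d₂ - ((b : ℝ) + d₃)) * hi₂ + ((a : ℝ) + d₃ - ((b : ℝ) + d₂)) * hi₃ ≤ 2 * T₂₃)
    (hsdd₁ : T₁₂ * ρ₁₂ + T₁₃ * ρ₁₃ < ((b : ℝ) - a) * lo₁)
    (hsdd₂ : T₁₂ * ρ₂₁ + T₂₃ * ρ₂₃ < ((b : ℝ) - a) * lo₂)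
    (hsdd₃ : T₁₃ * ρ₃₁ + T₂₃ * ρ₃₂ < ((b : ℝ) - a) * lo₃)
    : ∀ w₁ w₂ w₃ : ℝ, 0 < w₁ → 0 < w₂ → 0 < w₃ →
      A₁ * B₁ * ((a : ℝ) + d₁ - ((b : ℝ) + d₁)) * (w₁ * w₁) + A₁ * B₂ * ((a : ℝ) + d₁ - ((b : ℝ) + d₂)) * (w₁ * w₂) + A₁ * B₃ * ((a : ℝ) + d₁ - ((b : ℝ) + d₃)) * (w₁ * w₃) + A₂ * B₁ * ((a : ℝ) + d₂ - ((b : ℝ) + d₁)) * (w₂ * w₁) + A₂ * B₂ * ((a : ℝ) + d₂ - ((b : ℝ) + d₂)) * (w₂ * w₂) + A₂ * B₃ * ((a : ℝ) + d₂ - ((b : ℝ) + d₃)) * (w₂ * w₃) + A₃ * B₁ * ((a : ℝ) + d₃ - ((b : ℝ) + d₁)) * (w₃ * w₁) + A₃ * B₂ * ((a : ℝ) + d₃ - ((b : ℝ) + d₂)) * (w₃ * w₂) + A₃ * B₃ * ((a : ℝ) + d₃ - ((b : ℝ) + d₃)) * (w₃ * w₃) < 0 := by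
  intro w₁ w₂ w₃ hw₁ hw₂ hw₃
  set κ : ℝ := κn / κd with hκ_def
  have hκ : 0 < κ := div_pos hκn hκd
  have hlo₁ : lo₁ * B₁ ≤ κ * A₁ := by
    rw [hκ_def, div_mul_eq_mul_div, le_div_iff₀ hκd]; exact hlo₁'
  have hhi₁ : κ * A₁ ≤ hi₁ * B₁ := by
    rw [hκ_def, div_mul_eq_mul_div, div_le_iff₀ hκd]; exact hhi₁'
  have hlo₂ : lo₂ * B₂ ≤ κ * A₂ := by
    rw [hκ_def, div_mul_eq_mul_div, le_div_iff₀ hκd]; exact hlo₂'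
  have hhi₂ : κ * A₂ ≤ hi₂ * B₂ := by
    rw [hκ_def, div_mul_eq_mul_div, div_le_iff₀ hκd]; exact hhi₂'
  have hlo₃ : lo₃ * B₃ ≤ κ * A₃ := by
    rw [hκ_def, div_mul_eq_mul_div, le_div_iff₀ hκd]; exact hlo₃'
  have hhi₃ : κ * A₃ ≤ hi₃ * B₃ := by
    rw [hκ_def, div_mul_eq_mul_div, div_le_iff₀ hκd]; exact hhi₃'
  have hu₁ : 0 < B₁ * w₁ := mul_pos hB₁ hw₁
  have hu₂ : 0 < B₂ * w₂ := mul_pos hB₂ hw₂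
  have hu₃ : 0 < B₃ * w₃ := mul_pos hB₃ hw₃
  have dg₁ := diag_le_of_lo (w := w₁) hB₁ hab hlo₁
  have dg₂ := diag_le_of_lo (w := w₂) hB₂ hab hlo₂
  have dg₃ := diag_le_of_lo (w := w₃) hB₃ hab hlo₃
  have cr₁₂ := mul_le_mul_of_nonneg_right
    (cross_le_of_corners (c := ((a : ℝ) + d₁ - ((b : ℝ) + d₂))) (c' := ((a : ℝ) + d₂ - ((b : ℝ) + d₁))) hB₁ hB₂ hlo₁ hhi₁ hlo₂ hhi₂
      hc₁₂ll hc₁₂lh hc₁₂hl hc₁₂hh) (mul_pos hw₁ hw₂).le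
  have am₁₂ := two_mul_le_of_recip_weights (u := B₁ * w₁) (v := B₂ * w₂) hρ₁₂ hρρ₁₂ hT₁₂
  have cr₁₃ := mul_le_mul_of_nonneg_right
    (cross_le_of_corners (c := ((a : ℝ) + d₁ - ((b : ℝ) + d₃))) (c' := ((a : ℝ) + d₃ - ((b : ℝ) + d₁))) hB₁ hB₃ hlo₁ hhi₁ hlo₃ hhi₃
      hc₁₃ll hc₁₃lh hc₁₃hl hc₁₃hh) (mul_pos hw₁ hw₃).le
  have am₁₃ := two_mul_le_of_recip_weights (u := B₁ * w₁) (v := B₃ * w₃) hρ₁₃ hρρ₁₃ hT₁₃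
  have cr₂₃ := mul_le_mul_of_nonneg_right
    (cross_le_of_corners (c := ((a : ℝ) + d₂ - ((b : ℝ) + d₃))) (c' := ((a : ℝ) + d₃ - ((b : ℝ) + d₂))) hB₂ hB₃ hlo₂ hhi₂ hlo₃ hhi₃
      hc₂₃ll hc₂₃lh hc₂₃hl hc₂₃hh) (mul_pos hw₂ hw₃).le
  have am₂₃ := two_mul_le_of_recip_weights (u := B₂ * w₂) (v := B₃ * w₃) hρ₂₃ hρρ₂₃ hT₂₃
  have br₁ : (((a : ℝ) - b) * lo₁ + (T₁₂ * ρ₁₂ + T₁₃ * ρ₁₃)) * ((B₁ * w₁) * (B₁ * w₁)) < 0 :=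
    mul_neg_of_neg_of_pos (by linarith) (mul_pos hu₁ hu₁)
  have br₂ : (((a : ℝ) - b) * lo₂ + (T₁₂ * ρ₂₁ + T₂₃ * ρ₂₃)) * ((B₂ * w₂) * (B₂ * w₂)) < 0 :=
    mul_neg_of_neg_of_pos (by linarith) (mul_pos hu₂ hu₂)
  have br₃ : (((a : ℝ) - b) * lo₃ + (T₁₃ * ρ₃₁ + T₂₃ * ρ₃₂)) * ((B₃ * w₃) * (B₃ * w₃)) < 0 :=
    mul_neg_of_neg_of_pos (by linarith) (mul_pos hu₃ hu₃)
  have hκform : κ * (A₁ * B₁ * ((a : ℝ) + d₁ - ((b : ℝ) + d₁)) * (w₁ * w₁) + A₁ * B₂ * ((a : ℝ) + d₁ - ((b : ℝ) + d₂)) * (w₁ * w₂) + A₁ * B₃ * ((a : ℝ) + d₁ - ((b : ℝ) + d₃)) * (w₁ * w₃) + A₂ * B₁ * ((a : ℝ) + d₂ - ((b : ℝ) + d₁)) * (w₂ * w₁) + A₂ * B₂ * ((a : ℝ) + d₂ - ((b : ℝ) + d₂)) * (w₂ * w₂) + A₂ * B₃ * ((a : ℝ) + d₂ - ((b : ℝ)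 + d₃)) * (w₂ * w₃) + A₃ * B₁ * ((a : ℝ) + d₃ - ((b : ℝ) + d₁)) * (w₃ * w₁) + A₃ * B₂ * ((a : ℝ) + d₃ - ((b : ℝ) + d₂)) * (w₃ * w₂) + A₃ * B₃ * ((a : ℝ) + d₃ - ((b : ℝ) + d₃)) * (w₃ * w₃)) < 0 := by
    calc κ * (A₁ * B₁ * ((a : ℝ) + d₁ - ((b : ℝ) + d₁)) * (w₁ * w₁) + A₁ * B₂ * ((a : ℝ) + d₁ - ((b : ℝ) + d₂)) * (w₁ * w₂) + A₁ * B₃ * ((a : ℝ) + d₁ - ((b : ℝ) + d₃)) * (w₁ * w₃) + A₂ * B₁ * ((a : ℝ) + d₂ - ((b : ℝ) + d₁)) * (w₂ * w₁) + A₂ * B₂ * ((a : ℝ) + d₂ - ((b : ℝ) + d₂)) * (w₂ * w₂) + A₂ * B₃ * ((a : ℝ) + d₂ - ((b : ℝ) + d₃)) * (w₂ * w₃) + A₃ * B₁ * ((a : ℝ) + d₃ - ((b : ℝ) + d₁)) * (w₃ * w₁) + A₃ * B₂ * ((a : ℝ) + d₃ - ((b : ℝ) + d₂)) * (w₃ *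 w₂) + A₃ * B₃ * ((a : ℝ) + d₃ - ((b : ℝ) + d₃)) * (w₃ * w₃))
          = (((a : ℝ) - b) * (κ * A₁) * B₁ * (w₁ * w₁) + ((a : ℝ) - b) * (κ * A₂) * B₂ * (w₂ * w₂) + ((a : ℝ) - b) * (κ * A₃) * B₃ * (w₃ * w₃)) + ((((a : ℝ) + d₁ - ((b : ℝ) + d₂)) * (κ * A₁) * B₂ + ((a : ℝ) + d₂ - ((b : ℝ) + d₁)) * (κ * A₂) * B₁) * (w₁ * w₂) + (((a : ℝ) + d₁ - ((b : ℝ) + d₃)) * (κ * A₁) * B₃ + ((a : ℝ) + d₃ - ((b : ℝ) + d₁)) * (κ * A₃) * B₁) * (w₁ * w₃) + (((a : ℝ) + d₂ - ((b : ℝ) + d₃)) * (κ * A₂) * B₃ + ((a : ℝ) + d₃ - ((b : ℝ) + d₂)) * (κ * A₃) * B₂) * (w₂ * w₃)) := by ring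
      _ ≤ (((a : ℝ) - b) * lo₁ * ((B₁ * w₁) * (B₁ * w₁)) + ((a : ℝ) - b) * lo₂ * ((B₂ * w₂) * (B₂ * w₂)) + ((a : ℝ) - b) * lo₃ * ((B₃ * w₃) * (B₃ * w₃))) + (2 * T₁₂ * (B₁ * B₂) * (w₁ * w₂) + 2 * T₁₃ * (B₁ * B₃) * (w₁ * w₃) + 2 * T₂₃ * (B₂ * B₃) * (w₂ * w₃)) := by linarith [dg₁, dg₂, dg₃, cr₁₂, cr₁₃, cr₂₃]
      _ = (((a : ℝ) - b) * lo₁ * ((B₁ * w₁) * (B₁ * w₁)) + ((a : ℝ) - b) * lo₂ * ((B₂ * w₂) * (B₂ * w₂)) + ((a : ℝ) - b) * lo₃ * ((B₃ * w₃) * (B₃ * w₃))) + (2 * T₁₂ * ((B₁ * w₁) * (B₂ * w₂)) + 2 * T₁₃ * ((B₁ * w₁) * (B₃ * w₃)) + 2 * T₂₃ * ((B₂ * w₂) * (B₃ * w₃))) := by ring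
      _ ≤ (((a : ℝ) - b) * lo₁ * ((B₁ * w₁) * (B₁ * w₁)) + ((a : ℝ) - b) * lo₂ * ((B₂ * w₂) * (B₂ * w₂)) + ((a : ℝ) - b) * lo₃ * ((B₃ * w₃) * (B₃ * w₃))) + (T₁₂ * (ρ₁₂ * ((B₁ * w₁) * (B₁ * w₁)) + ρ₂₁ * ((B₂ * w₂) * (B₂ * w₂))) + T₁₃ * (ρ₁₃ * ((B₁ * w₁) * (B₁ * w₁)) + ρ₃₁ * ((B₃ * w₃) * (B₃ * w₃))) + T₂₃ * (ρ₂₃ * ((B₂ * w₂) * (B₂ * w₂)) + ρ₃₂ * ((B₃ * w₃) * (B₃ * w₃)))) := by linarith [am₁₂, am₁₃, am₂₃]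
      _ = (((a : ℝ) - b) * lo₁ + (T₁₂ * ρ₁₂ + T₁₃ * ρ₁₃)) * ((B₁ * w₁) * (B₁ * w₁)) + (((a : ℝ) - b) * lo₂ + (T₁₂ * ρ₂₁ + T₂₃ * ρ₂₃)) * ((B₂ * w₂) * (B₂ * w₂)) + (((a : ℝ) - b) * lo₃ + (T₁₃ * ρ₃₁ + T₂₃ * ρ₃₂)) * ((B₃ * w₃) * (B₃ * w₃)) := by ring
      _ < 0 := by linarith [br₁, br₂, br₃]
  by_contra hcon
  have : 0 ≤ κ * (A₁ * B₁ * ((a : ℝ) + d₁ - ((b : ℝ) + d₁)) * (w₁ * w₁) + A₁ * B₂ * ((a : ℝ) + d₁ - ((b : ℝ) + d₂)) * (w₁ * w₂) + A₁ * B₃ * ((a : ℝ) + d₁ - ((b : ℝ) + d₃)) * (w₁ * w₃) + A₂ * B₁ * ((a : ℝ) + d₂ - ((b : ℝ) + d₁)) * (w₂ * w₁) + A₂ * B₂ * ((a : ℝ) + d₂ - ((b : ℝ) + d₂)) * (w₂ * w₂) + A₂ * B₃ * ((a : ℝ) + d₂ - ((b : ℝ) + d₃)) * (w₂ * w₃)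 + A₃ * B₁ * ((a : ℝ) + d₃ - ((b : ℝ) + d₁)) * (w₃ * w₁) + A₃ * B₂ * ((a : ℝ) + d₃ - ((b : ℝ) + d₂)) * (w₃ * w₂) + A₃ * B₃ * ((a : ℝ) + d₃ - ((b : ℝ) + d₃)) * (w₃ * w₃)) := mul_nonneg hκ.le (not_lt.mp hcon)
  linarith

end Summit.ValiantsHypothesis.ValiantsHypothesis.Theorems.LacunarySymmetroidMatrixDescartes.Census
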